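import Summits.Ventures.Crystal3D.Bulk.LocalTwelve
import HarnessLib

/-!
# The statement `BulkCrystallization3D K` unfolded to Mathlib terms (statement-audit aid)

HONEST FRAMING. Part of the venture `Summits/Ventures/Crystal3D` (cell `pub-crystal3d`, phase 2; sub-cell
`crystal3d-paper`, HUMAN RULING D-0044; seat crystal3d-writer g2; lead RULING #234 (4): «P6 — YES, optional,
statement-audit aid»). This file asserts NOTHING about whether `BulkCrystallization3D K` holds for any `K`. It
records, as kernel-checked `↔` / `=` statements, what the proposition `BulkCrystallization3D K`
(`Bulk/LocalTwelve.lean`) SAYS once the venture's ten short definitions (`IsStickyGroundState`, `IsUnitPacking`,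
`numContacts`, `contactPairs`, `nonClosePacked`, `IsClosePackedShell`, `contactShell`, `contactNeighbors`,
the Literature's `IsArrangedIn`, and — separately — `maxContacts`, `fccKissingPattern`, `hcpKissingPattern`)
are unfolded: only Mathlib notions (`EuclideanSpace ℝ (Fin 3)`, `dist`, `Finset.card`, `Finset.filter`,
`Real.rpow`, `LinearIsometry`, `sSup`, `Set.image`) and two explicit twelve-element sets of integer vectors
remain. A referee reads the right-hand sides instead of chasing the definitions.

Why `simp only` and not `Iff.rfl`: the two sides ARE the same proposition up to the `DecidablePred` instances
hidden in the two `Finset.filter`s (the venture's definitions elaborate them classically under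
`open scoped Classical`; a freshly written filter elaborates its own instance); such instances are
`Subsingleton`-equal, and `simp only [definitions]` performs exactly that replacement, whereas a bare
`Iff.rfl` is rejected by the elaborator. No mathematical content enters: the `simp only` set is the list of
definitions and nothing else. Closure: standard axioms.

Contents: `bulkCrystallization3D_iff_unfolded`, `maxContacts_three_eq_sSup`, `fccKissingPattern_eq_image`,
`hcpKissingPattern_eq_image` (the last three by `rfl`). Nothing here is used by any other file; nothing here
concerns GAP(1.26), the census, or the K25 lane.
-/

noncomputable section

open Finset

namespace Summit.Ventures.Crystal3D

open Literature.Geometry.DiscreteGeometry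

open scoped Classical in
/-- **`BulkCrystallization3D K`, unfolded.** For every `N` and every `x : Fin N → ℝ³`: IF `x` is a packing of
unit-DIAMETER balls (pairwise centre distance `≥ 1`) whose number of touching pairs (`dist = 1`) equals the
maximum `maxContacts 3 N` over all such packings (a sticky-sphere ground state), THEN the number of indices `i`
whose doubled contact shell `{2(xⱼ − xᵢ) : j ≠ i, dist xᵢ xⱼ = 1}` is NOT the image `{2·A p : p ∈ P}` of the fcc
pattern or of the hcp pattern `P` under some linear isometry `A` of `ℝ³` is at most `K · N^{2/3}` (real power).
Proved by unfolding the ten definitions only (see the module docstring for why this is `simp only`, not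
`Iff.rfl`). [folklore] -/
theorem bulkCrystallization3D_iff_unfolded (K : ℝ) :
    BulkCrystallization3D K ↔
      ∀ (N : ℕ) (x : Fin N → EuclideanSpace ℝ (Fin 3)),
        ((Pairwise fun i j => (1 : ℝ) ≤ dist (x i) (x j)) ∧
            (univ.filter fun p : Fin N × Fin N => p.1 < p.2 ∧ dist (x p.1) (x p.2) = 1).card = maxContacts 3 N) →
          ((univ.filter fun i : Fin N =>
                ¬ ((∃ A : EuclideanSpace ℝ (Fin 3) →ₗᵢ[ℝ] EuclideanSpace ℝ (Fin 3),
                      (fun j => (2 : ℝ) • (x j - x i)) ''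
                          ↑(univ.filter fun j : Fin N => j ≠ i ∧ dist (x i) (x j) = 1)
                        = (fun p => (2 : ℝ) • A p) '' ↑fccKissingPattern) ∨
                   (∃ A : EuclideanSpace ℝ (Fin 3) →ₗᵢ[ℝ] EuclideanSpace ℝ (Fin 3),
                      (fun j => (2 : ℝ) • (x j - x i)) ''
                          ↑(univ.filter fun j : Fin N => j ≠ i ∧ dist (x i) (x j) = 1)
                        = (fun p => (2 : ℝ) • A p) '' ↑hcpKissingPattern))).card : ℝ)
            ≤ K * (N : ℝ) ^ ((2 : ℝ) / 3) := by
  simp only [BulkCrystallization3D, IsStickyGroundState, IsUnitPacking, numContacts, contactPairs, nonClosePacked,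
    IsClosePackedShell, IsArrangedIn, contactShell, contactNeighbors]

/-- **`C(N) = maxContacts 3 N`, unfolded**: the supremum (attained, `exists_numContacts_eq_maxContacts`) of the
numbers `k` such that some packing of `N` unit-diameter balls in `ℝ³` has exactly `k` touching pairs. By `rfl`.
[folklore] -/
theorem maxContacts_three_eq_sSup (N : ℕ) :
    maxContacts 3 N = sSup {k : ℕ | ∃ x : Fin N → EuclideanSpace ℝ (Fin 3),
      (Pairwise fun i j => (1 : ℝ) ≤ dist (x i) (x j)) ∧
      (univ.filter fun p : Fin N × Fin N => p.1 < p.2 ∧ dist (x p.1) (x p.2) = 1).card = k} :=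
  rfl

/-- **The fcc pattern, unfolded**: the image of the twelve integer vectors `fccInt` = all permutations of
`(±1, ±1, 0)` under `v ↦ v/√2` (the vertices of a cuboctahedron, unit vectors). By `rfl`.
[cite: HalesDSP2012, §1.3, Fig. 1.11] -/
theorem fccKissingPattern_eq_image :
    fccKissingPattern = fccInt.image fun v => (Real.sqrt (2 : ℕ))⁻¹ • intVec v :=
  rfl

/-- **The hcp pattern, unfolded**: the image of the twelve integer vectors `hcpInt` (hexagonal layer of
`3·fccInt`, its upper triangle, and the reflected lower triangle; squared norm `18`) under `v ↦ v/√18` (the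
vertices of an anticuboctahedron, unit vectors). By `rfl`. [cite: HalesDSP2012, §1.3, Fig. 1.11] -/
theorem hcpKissingPattern_eq_image :
    hcpKissingPattern = hcpInt.image fun v => (Real.sqrt (18 : ℕ))⁻¹ • intVec v :=
  rfl

end Summit.Ventures.Crystal3D

end
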